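import Summits.BirchSwinnertonDyer.BirchSwinnertonDyer.Theorems.ByReductionTypeAtTwoSupersingularColemanRoadV5
import HarnessLib

/-!
# Route `ByReductionTypeAtTwo` (rung K4), crux `SupersingularRankZeroAtTwo` (item
# stmt-BirchSwinnertonDyer-19097), line `signed_halves_two`: THE COLEMAN ROAD, v6 — «m = 0» OUT of the
# image guard (audit-1 ssCK ADDENDUM-2 @9267d43c379fabb7 ∧ audit-2 KO06 sheet @5452f19c6853ca98 CONCUR:
# F3c is a READING OF PRINT on `Λ_Γ = ℤ₂⟦T⟧`, no image guard), and the seventh stub EXACTLY `μ(X⁺) = 0`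
# (planner RULINGS 02:38:01Z (A)(iii) / 03:49:34Z (D3); seat `bsd-2adic-ss-1`, GEN 8)

HONEST FRAMING (cell `bsd-2adic`, run/shared/lean/pub/bsd-2adic/, HUMAN RULINGS D-0036/D-0054/D-0074):
THEOREMS ONLY; every research input an explicit hypothesis; no definition, no named fact, no instance,
no `sorry`; nothing booked; BSD is NOT proved by any of this. PARTITION (D-0054): X5@2 good-supersingular,
`a₂ = 0` sub-row (B1·O1; 208 rank-`0` classes = 206 `ρ_{E,2^∞}`-onto + 2 not) × `p = 2` —
types-the-object-of; closes none. The CLASS SIDE (kit p490756 + 208 class files, display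
`…_of_colemanKatoV5` / `…_of_signedUpper`) is UNTOUCHED: the v6 package implies the v5 package
(`colemanKatoV5_of_colemanKatoV6`), so every v5 door is fed by the v6 stub (ruling (D3)'s condition).

## v6 vs v5 (two audited moves, nothing else)

* F3b EXACT again: `ι G = ϖ·ι L♭` for EVERY curve of the sub-row — the `2`-integrality of Kato's zeta
  element on the `Γ`-tower is a READING OF PRINT at `p = 2` (Kato §13.8 torsion-freeness + §13.14's
  parity-free height-one membership on the LOCAL ring `Λ_Γ = ℤ₂⟦T⟧`, reflexivity of the free module; the
  only Galois input `E(ℚ)[2] = 0` is automatic at a good supersingular `2`; NO image guard) — audit-1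
  ADDENDUM-2 rows / audit-2 U1 + U2. v5's `∃ m, ι G = 2^m·ϖ·ι L♭` + «`m = 0` under the guard» was
  strictly weaker-scoped; v6 ⇒ v5 with `m := 0`.
* The guard keeps ONLY F4 at the height-one `𝔭 ∋ 2`: `TwoAdicSurjective W → length_𝔭 X⁰ ≤ length_𝔭 𝐇¹/Z`
  there [Kato 12.5 (4) at `2` under (12.5.2) = Kurihara–Otsuki p. 564, P-ASSERT; residue ONE theorem-sized
  item: [KK4] 0.8 / [Ru3] 2.3.3 for Kato's Euler system of `T₂E` over `ℚ_∞` at `(2)`].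
* Seventh stub = `μ(X⁺(E/ℚ_∞)) = 0` on the 2 non-surjective classes (107217l, 184041bk): with F3b exact,
  the rational road `exists_mul_eq_of_colemanSkeletonRatV5_of_mu` takes `G₀ := G` and needs exactly
  `2 ∤ g` (CONJECTURE / MATH-BOUND, 2 classes; no `μ` certificate exists — algebraic `μ` is not a kit
  quantity); `G = 0` is the trivial case `h = 0`.
After v6: P-at-2 = {F3a, F3b (=F3c), F4rat}; READ-AT-2 = {F1 (7.21)@2 memo (LAG); F4@(2) P-ASSERT};
PUB = {Kato 12.4 (1)(2)}; + stub (2) Kim `Γ`-Euler characteristic @2; + `μ(X⁺) = 0` on 2 classes;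
`a₂ = ±2` MATH-BOUND unchanged.
References: [Kobayashi2003] Thm. 4.1, 6.3, 7.3; [Kato2004Asterisque] Thm. 12.4–12.6, §13.8, §13.14;
[Sprung2012] Def. 6.1; [KuriharaOtsuki2006] p. 564; [BDKim2013] Cor. 3.15; [Miller2011LMS] Def. 1.1.
-/

set_option autoImplicit false
-- the Theorems namespace of this sub repeats the summit name by design (D-0017 nested layout)
set_option linter.dupNamespace false

noncomputable section

open scoped Classical MatrixGroups ModularForm
open CongruenceSubgroup WeierstrassCurve Literature.NumberTheory.EllipticCurves
  Literature.NumberTheory.EllipticCurves.ModularForms Literature.NumberTheory.EllipticCurves.Sprung2017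
  Literature.NumberTheory.EllipticCurves.Rank1Residual Literature.NumberTheory.EllipticCurves.Rank1Residual.Typed
  Literature.NumberTheory.EllipticCurves.Kobayashi2003 Literature.NumberTheory.EllipticCurves.IwasawaDual
  ZpExtension Summit.BirchSwinnertonDyer.Rank1Residual Summit.BirchSwinnertonDyer.Rank1Residual.Supersingular
  Summit.BirchSwinnertonDyer.Rank1Residual.X5.O1

namespace Summit.BirchSwinnertonDyer.BirchSwinnertonDyer.Theorems
namespace SSColemanRoad

/-! ## §1 At the datum: v6 ⇒ v5, and the non-surjective branch from `μ(X⁺) = 0` -/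

section Datum

variable {W : WeierstrassCurve ℚ} [W.IsElliptic] {κ : ZpExtension ℚ 2} {γ : Field.absoluteGaloisGroup ℚ}
  [ContinuousSMul ℤ_[2] (W.tateModule 2)]
  {D : SignedSelmerDualData W κ γ 1} {ϖ : ℚ} {Lplus Lminus : IwasawaAlgebra 2}

/-- **v6 ⇒ v5 at the datum** (`m := 0`; the guarded `m = 0` of v5 holds outright). So every v5 door —
the kit `bsdp_two_of_colemanKatoV5_of_pow_dvd` and the 206 class instances `…_of_colemanKatoV5` — is fed
by the v6 package unchanged. [cite: Kato2004Asterisque, Thm. 12.5 (3)(4) (p. 222) and §13.14] -/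
theorem colemanKatoV5_of_colemanKatoV6
    (h : ∃ (I : Kato2004.IwasawaH1Data W 2 κ γ) (Y : W.FineSelmerDualData κ γ)
          (P : Submodule (IwasawaAlgebra 2) (IwasawaAlgebra 2))
          (loc : I.H →ₗ[IwasawaAlgebra 2] P) (toX : P →ₗ[IwasawaAlgebra 2] D.X)
          (δ : D.X →ₗ[IwasawaAlgebra 2] Y.X) (Z : Submodule (IwasawaAlgebra 2) I.H)
          (G : IwasawaAlgebra 2),
          Function.Exact loc toX ∧ Function.Exact toX δ ∧
          G ∈ Submodule.map (P.subtype ∘ₗ loc) Z ∧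
          iwasawaToPowerSeries 2 G =
            PowerSeries.C (ϖ : ℚ_[2]) * iwasawaToPowerSeries 2 (kobayashiL 1 Lplus Lminus) ∧
          (∀ 𝔭 : PrimeSpectrum (IwasawaAlgebra 2), 𝔭.asIdeal.height = 1 →
            PowerSeries.C (2 : ℤ_[2]) ∉ 𝔭.asIdeal →
            Literature.NumberTheory.EllipticCurves.Module.lengthAt (IwasawaAlgebra 2) Y.X 𝔭 ≤
              Literature.NumberTheory.EllipticCurves.Module.lengthAt (IwasawaAlgebra 2) (I.H ⧸ Z) 𝔭) ∧
          (TwoAdicSurjective W →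
            ∀ 𝔭 : PrimeSpectrum (IwasawaAlgebra 2), 𝔭.asIdeal.height = 1 →
              PowerSeries.C (2 : ℤ_[2]) ∈ 𝔭.asIdeal →
              Literature.NumberTheory.EllipticCurves.Module.lengthAt (IwasawaAlgebra 2) Y.X 𝔭 ≤
                Literature.NumberTheory.EllipticCurves.Module.lengthAt (IwasawaAlgebra 2) (I.H ⧸ Z) 𝔭)) :
    ∃ (I : Kato2004.IwasawaH1Data W 2 κ γ) (Y : W.FineSelmerDualData κ γ)
      (P : Submodule (IwasawaAlgebra 2) (IwasawaAlgebra 2))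
      (loc : I.H →ₗ[IwasawaAlgebra 2] P) (toX : P →ₗ[IwasawaAlgebra 2] D.X)
      (δ : D.X →ₗ[IwasawaAlgebra 2] Y.X) (Z : Submodule (IwasawaAlgebra 2) I.H)
      (G : IwasawaAlgebra 2) (m : ℕ),
      Function.Exact loc toX ∧ Function.Exact toX δ ∧
      G ∈ Submodule.map (P.subtype ∘ₗ loc) Z ∧
      iwasawaToPowerSeries 2 G =
        PowerSeries.C ((2 : ℚ_[2]) ^ m * (ϖ : ℚ_[2])) *
          iwasawaToPowerSeries 2 (kobayashiL 1 Lplus Lminus) ∧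
      (∀ 𝔭 : PrimeSpectrum (IwasawaAlgebra 2), 𝔭.asIdeal.height = 1 →
        PowerSeries.C (2 : ℤ_[2]) ∉ 𝔭.asIdeal →
        Literature.NumberTheory.EllipticCurves.Module.lengthAt (IwasawaAlgebra 2) Y.X 𝔭 ≤
          Literature.NumberTheory.EllipticCurves.Module.lengthAt (IwasawaAlgebra 2) (I.H ⧸ Z) 𝔭) ∧
      (TwoAdicSurjective W → m = 0 ∧
        ∀ 𝔭 : PrimeSpectrum (IwasawaAlgebra 2), 𝔭.asIdeal.height = 1 →
          PowerSeries.C (2 : ℤ_[2]) ∈ 𝔭.asIdeal →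
          Literature.NumberTheory.EllipticCurves.Module.lengthAt (IwasawaAlgebra 2) Y.X 𝔭 ≤
            Literature.NumberTheory.EllipticCurves.Module.lengthAt (IwasawaAlgebra 2) (I.H ⧸ Z) 𝔭) := by
  obtain ⟨I, Y, P, loc, toX, δ, Z, G, hPX, hXY, hGZ, hιG, hESrat, hES2⟩ := h
  refine ⟨I, Y, P, loc, toX, δ, Z, G, 0, hPX, hXY, hGZ, ?_, hESrat, fun hs ↦ ⟨rfl, hES2 hs⟩⟩
  rw [hιG, pow_zero, one_mul]

/-- **The non-surjective branch at the datum: stub (4) from the v6 package + `X⁰` torsion + `𝐇¹` torsion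
free of rank `≤ 1` + `μ(X⁺) = 0`** (no image input). If `G = 0` take `h = 0`; otherwise
`exists_mul_eq_of_colemanSkeletonRatV5_of_mu` with `G₀ := G`, `m := 0`.
[cite: Kobayashi2003, Thm. 4.1 first display (p. 8)] [cite: Kato2004Asterisque, Thm. 12.5 (3), §13.14] -/
theorem exists_charGenerator_mul_eq_of_colemanKatoV6_of_mu (hγ : κ.IsTopGenerator γ)
    (I : Kato2004.IwasawaH1Data W 2 κ γ) [Module.IsTorsionFree (IwasawaAlgebra 2) I.H]
    (hrank : Module.rank (IwasawaAlgebra 2) I.H ≤ 1)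
    (Y : W.FineSelmerDualData κ γ) (P : Submodule (IwasawaAlgebra 2) (IwasawaAlgebra 2))
    (loc : I.H →ₗ[IwasawaAlgebra 2] P) (toX : P →ₗ[IwasawaAlgebra 2] D.X)
    (δ : D.X →ₗ[IwasawaAlgebra 2] Y.X)
    (hPX : Function.Exact loc toX) (hXY : Function.Exact toX δ)
    (hY : Module.IsTorsion (IwasawaAlgebra 2) Y.X)
    (Z : Submodule (IwasawaAlgebra 2) I.H) {G : IwasawaAlgebra 2}
    (hGZ : G ∈ Submodule.map (P.subtype ∘ₗ loc) Z)
    (hES : ∀ 𝔭 : PrimeSpectrum (IwasawaAlgebra 2), 𝔭.asIdeal.height = 1 →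
      PowerSeries.C (2 : ℤ_[2]) ∉ 𝔭.asIdeal →
      Literature.NumberTheory.EllipticCurves.Module.lengthAt (IwasawaAlgebra 2) Y.X 𝔭 ≤
        Literature.NumberTheory.EllipticCurves.Module.lengthAt (IwasawaAlgebra 2) (I.H ⧸ Z) 𝔭)
    (hιG : iwasawaToPowerSeries 2 G =
      PowerSeries.C (ϖ : ℚ_[2]) * iwasawaToPowerSeries 2 (kobayashiL 1 Lplus Lminus))
    (hμ : ∀ g : IwasawaAlgebra 2, D.charIdeal = Ideal.span {g} → ¬ PowerSeries.C (2 : ℤ_[2]) ∣ g) :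
    ∃ g h : IwasawaAlgebra 2, D.charIdeal = Ideal.span {g} ∧
      iwasawaToPowerSeries 2 (g * h) =
        PowerSeries.C (ϖ : ℚ_[2]) * iwasawaToPowerSeries 2 (kobayashiL 1 Lplus Lminus) := by
  obtain ⟨g, hg⟩ := (charIdeal_isPrincipal_holds 2 D.X).principal
  have hg' : D.charIdeal = Ideal.span {g} := hg
  by_cases hG : G = 0
  · exact ⟨g, 0, hg', by rw [mul_zero, map_zero, ← hιG, hG, map_zero]⟩
  · have hιG' : iwasawaToPowerSeries 2 G =
        PowerSeries.C ((2 : ℚ_[2]) ^ 0 * (ϖ : ℚ_[2])) *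
          iwasawaToPowerSeries 2 (kobayashiL 1 Lplus Lminus) := by
      rw [pow_zero, one_mul]; exact hιG
    obtain ⟨h, hh⟩ := exists_mul_eq_of_colemanSkeletonRatV5_of_mu hγ I hrank Y D loc P.subtype
      P.injective_subtype toX δ hPX hXY hY Z hGZ hES hιG' hG hιG hg' (hμ g hg')
    exact ⟨g, h, hg', hh⟩

end Datum

/-! ## §2 ∀-closed: the registered v3 signature of `stub_zeroSignedUpper` and the crux by name (v6) -/

/-- **`stub_zeroSignedUpper` (v3) — its REGISTERED SIGNATURE VERBATIM — from the two Kato facts, the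
∀-closed v6 package `hCK` and the seventh v6 stub `hμ` (`μ(X⁺(E/ℚ_∞)) = 0` on the 2 non-surjective
classes)**, by cases on `TwoAdicSurjective W`: surjective ⇒ v6 ⇒ v5 ⇒
`signedUpperDivisibility_two_of_colemanKatoV5`; non-surjective ⇒ the rational road + `μ = 0`.
[cite: Kobayashi2003, Thm. 4.1 (p. 8) and §7 (pp. 12–13)] [cite: Kato2004Asterisque, Thm. 12.4–12.6 (pp. 221–222)]
[cite: KuriharaOtsuki2006, p. 564] -/
theorem zeroSignedUpper_of_colemanKatoV6AtTwo (h124 : Kato2004.thm12_4)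
    (hX0 : Kato2004_fineSelmerDual_isTorsion)
    (hCK : ∀ (W : WeierstrassCurve ℚ) [W.IsElliptic] [W.IsGloballyMinimal],
      ¬ W.HasCM → W.analyticRank = 0 → GoodSS W 2 → W.frobeniusTrace 2 = 0 →
      ∀ (κ : ZpExtension ℚ 2) (γ : Field.absoluteGaloisGroup ℚ),
        κ.IsCyclotomic → κ.IsTopGenerator γ → IsCyclotomicVariable 2 γ →
        ∀ [NeZero (W.conductorNorm ℤ)] (f : CuspForm (Gamma0 (W.conductorNorm ℤ)) 2),
          IsNewformOf W f → ∀ (ϖ : ℚ), (ϖ : ℝ) * W.realPeriodRat = plusPeriod f →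
        ∀ (Lplus Lminus : IwasawaAlgebra 2), IsPollackPair f 2 Lplus Lminus →
        ∀ (D : SignedSelmerDualData W κ γ 1) [ContinuousSMul ℤ_[2] (W.tateModule 2)],
          ∃ (I : Kato2004.IwasawaH1Data W 2 κ γ) (Y : W.FineSelmerDualData κ γ)
            (P : Submodule (IwasawaAlgebra 2) (IwasawaAlgebra 2))
            (loc : I.H →ₗ[IwasawaAlgebra 2] P) (toX : P →ₗ[IwasawaAlgebra 2] D.X)
            (δ : D.X →ₗ[IwasawaAlgebra 2] Y.X) (Z : Submodule (IwasawaAlgebra 2) I.H)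
            (G : IwasawaAlgebra 2),
            Function.Exact loc toX ∧ Function.Exact toX δ ∧
            G ∈ Submodule.map (P.subtype ∘ₗ loc) Z ∧
            iwasawaToPowerSeries 2 G =
              PowerSeries.C (ϖ : ℚ_[2]) * iwasawaToPowerSeries 2 (kobayashiL 1 Lplus Lminus) ∧
            (∀ 𝔭 : PrimeSpectrum (IwasawaAlgebra 2), 𝔭.asIdeal.height = 1 →
              PowerSeries.C (2 : ℤ_[2]) ∉ 𝔭.asIdeal →
              Literature.NumberTheory.EllipticCurves.Module.lengthAt (IwasawaAlgebra 2) Y.X 𝔭 ≤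
                Literature.NumberTheory.EllipticCurves.Module.lengthAt (IwasawaAlgebra 2) (I.H ⧸ Z) 𝔭) ∧
            (TwoAdicSurjective W →
              ∀ 𝔭 : PrimeSpectrum (IwasawaAlgebra 2), 𝔭.asIdeal.height = 1 →
                PowerSeries.C (2 : ℤ_[2]) ∈ 𝔭.asIdeal →
                Literature.NumberTheory.EllipticCurves.Module.lengthAt (IwasawaAlgebra 2) Y.X 𝔭 ≤
                  Literature.NumberTheory.EllipticCurves.Module.lengthAt (IwasawaAlgebra 2) (I.H ⧸ Z) 𝔭))
    (hμ : ∀ (W : WeierstrassCurve ℚ) [W.IsElliptic] [W.IsGloballyMinimal],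
      ¬ W.HasCM → W.analyticRank = 0 → GoodSS W 2 → W.frobeniusTrace 2 = 0 →
      ¬ TwoAdicSurjective W →
      ∀ (κ : ZpExtension ℚ 2) (γ : Field.absoluteGaloisGroup ℚ),
        κ.IsCyclotomic → κ.IsTopGenerator γ → IsCyclotomicVariable 2 γ →
        ∀ (D : SignedSelmerDualData W κ γ 1) (g : IwasawaAlgebra 2),
          D.charIdeal = Ideal.span {g} → ¬ PowerSeries.C (2 : ℤ_[2]) ∣ g) :
    ∀ (W : WeierstrassCurve ℚ) [W.IsElliptic] [W.IsGloballyMinimal],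
      ¬ W.HasCM → W.analyticRank = 0 → GoodSS W 2 → W.frobeniusTrace 2 = 0 →
      ∀ (κ : ZpExtension ℚ 2) (γ : Field.absoluteGaloisGroup ℚ),
        κ.IsCyclotomic → κ.IsTopGenerator γ → IsCyclotomicVariable 2 γ →
        ∀ [NeZero (W.conductorNorm ℤ)] (f : CuspForm (Gamma0 (W.conductorNorm ℤ)) 2),
          IsNewformOf W f → ∀ (ϖ : ℚ), (ϖ : ℝ) * W.realPeriodRat = plusPeriod f →
        ∀ (Lplus Lminus : IwasawaAlgebra 2), IsPollackPair f 2 Lplus Lminus →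
        ∀ (D : SignedSelmerDualData W κ γ 1),
          ∃ g h : IwasawaAlgebra 2, D.charIdeal = Ideal.span {g} ∧
            iwasawaToPowerSeries 2 (g * h) =
              PowerSeries.C (ϖ : ℚ_[2]) * iwasawaToPowerSeries 2 (kobayashiL 1 Lplus Lminus) := by
  intro W _ _ hcm hr hss ha
  by_cases hs : TwoAdicSurjective W
  · exact signedUpperDivisibility_two_of_colemanKatoV5 h124 hX0 hs
      (fun κ γ hκ hγ hγ' _ f hf ϖ hϖ Lp Lm hPP D _ ↦
        colemanKatoV5_of_colemanKatoV6 (hCK W hcm hr hss ha κ γ hκ hγ hγ' f hf ϖ hϖ Lp Lm hPP D))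
  · intro κ γ hκ hγ hγ' _ f hf ϖ hϖ Lplus Lminus hPP D
    haveI : ContinuousSMul ℤ_[2] (W.tateModule 2) := TateModule.continuousSMul_padicInt
    obtain ⟨I, Y, P, loc, toX, δ, Z, G, hPX, hXY, hGZ, hιG, hESrat, -⟩ :=
      hCK W hcm hr hss ha κ γ hκ hγ hγ' f hf ϖ hϖ Lplus Lminus hPP D
    have hY : Module.IsTorsion (IwasawaAlgebra 2) Y.X := hX0 W 2 κ γ hκ hγ Y
    obtain ⟨htf, hrank⟩ := h124.isTorsionFree_and_rank_le_one W 2 hκ hγ I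
    haveI := htf
    exact exists_charGenerator_mul_eq_of_colemanKatoV6_of_mu hγ I hrank Y P loc toX δ hPX hXY hY Z
      hGZ hESrat hιG (hμ W hcm hr hss ha hs κ γ hκ hγ hγ' D)

/-- **Crux `SupersingularRankZeroAtTwo` BY NAME from the seven v6 stubs of line `signed_halves_two`**
(`hPub` = `stub_ssPub`, `hKato` = `stub_katoPub`, `hEC` = `stub_zeroSignedEulerChar`, `hlow` =
`stub_zeroKobayashiLower`, `hCK` = `stub_zeroColemanKato` (v6 package), `hμ` = `stub_zeroMuPlusOfNonSurj`,
`hTwo` = `stub_traceTwoMillerHalves`) — p434732's `supersingularRankZeroAtTwo_of_line_eulerChar` fed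
through `zeroSignedUpper_of_colemanKatoV6AtTwo`.
[cite: Kobayashi2003, Thm. 1.2, Thm. 4.1, §7 and Conjecture (p. 2)] [cite: BDKim2013, Thm. 1.1 and Cor. 3.15]
[cite: Kato2004Asterisque, Thm. 12.4–12.6 (pp. 221–222)] [cite: Miller2011LMS, Def. 1.1] -/
theorem supersingularRankZeroAtTwo_of_line_colemanKatoV6
    (hPub : nonempty_modularParametrizationData ∧ rank_eq_analyticRank_of_analyticRank_le_one)
    (hKato : Kato2004.thm12_4 ∧ Kato2004_fineSelmerDual_isTorsion)
    (hEC : ∀ (W : WeierstrassCurve ℚ) [W.IsElliptic] [W.IsGloballyMinimal],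
        ¬ W.HasCM → W.analyticRank = 0 → GoodSS W 2 → W.frobeniusTrace 2 = 0 →
        ∀ (κ : ZpExtension ℚ 2) (γ : Field.absoluteGaloisGroup ℚ),
          κ.IsCyclotomic → κ.IsTopGenerator γ → Finite (W.selmerGroupPInfty 2) →
          Finite (endInvariants (conjSignedSelmerInfty W κ 1 γ - 1)) ∧
            ∃ u : ℤ_[2]ˣ, (Nat.card (endInvariants (conjSignedSelmerInfty W κ 1 γ - 1)) : ℚ_[2]) =
              ((u : ℤ_[2]) : ℚ_[2]) * ((2 : ℕ) : ℚ_[2]) ^ (padicValNat 2 W.tamagawaProduct) *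
                (Nat.card (W.selmerGroupPInfty 2) : ℚ_[2]) *
                  (Nat.card (EndCoinvariants (conjSignedSelmerInfty W κ 1 γ - 1)) : ℚ_[2]))
    (hlow : ∀ (W : WeierstrassCurve ℚ) [W.IsElliptic] [W.IsGloballyMinimal],
      ¬ W.HasCM → W.analyticRank = 0 → GoodSS W 2 → W.frobeniusTrace 2 = 0 →
        KobayashiLowerDivisibility W 2 1)
    (hCK : ∀ (W : WeierstrassCurve ℚ) [W.IsElliptic] [W.IsGloballyMinimal],
      ¬ W.HasCM → W.analyticRank = 0 → GoodSS W 2 → W.frobeniusTrace 2 = 0 →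
      ∀ (κ : ZpExtension ℚ 2) (γ : Field.absoluteGaloisGroup ℚ),
        κ.IsCyclotomic → κ.IsTopGenerator γ → IsCyclotomicVariable 2 γ →
        ∀ [NeZero (W.conductorNorm ℤ)] (f : CuspForm (Gamma0 (W.conductorNorm ℤ)) 2),
          IsNewformOf W f → ∀ (ϖ : ℚ), (ϖ : ℝ) * W.realPeriodRat = plusPeriod f →
        ∀ (Lplus Lminus : IwasawaAlgebra 2), IsPollackPair f 2 Lplus Lminus →
        ∀ (D : SignedSelmerDualData W κ γ 1) [ContinuousSMul ℤ_[2] (W.tateModule 2)],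
          ∃ (I : Kato2004.IwasawaH1Data W 2 κ γ) (Y : W.FineSelmerDualData κ γ)
            (P : Submodule (IwasawaAlgebra 2) (IwasawaAlgebra 2))
            (loc : I.H →ₗ[IwasawaAlgebra 2] P) (toX : P →ₗ[IwasawaAlgebra 2] D.X)
            (δ : D.X →ₗ[IwasawaAlgebra 2] Y.X) (Z : Submodule (IwasawaAlgebra 2) I.H)
            (G : IwasawaAlgebra 2),
            Function.Exact loc toX ∧ Function.Exact toX δ ∧
            G ∈ Submodule.map (P.subtype ∘ₗ loc) Z ∧
            iwasawaToPowerSeries 2 G =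
              PowerSeries.C (ϖ : ℚ_[2]) * iwasawaToPowerSeries 2 (kobayashiL 1 Lplus Lminus) ∧
            (∀ 𝔭 : PrimeSpectrum (IwasawaAlgebra 2), 𝔭.asIdeal.height = 1 →
              PowerSeries.C (2 : ℤ_[2]) ∉ 𝔭.asIdeal →
              Literature.NumberTheory.EllipticCurves.Module.lengthAt (IwasawaAlgebra 2) Y.X 𝔭 ≤
                Literature.NumberTheory.EllipticCurves.Module.lengthAt (IwasawaAlgebra 2) (I.H ⧸ Z) 𝔭) ∧
            (TwoAdicSurjective W →
              ∀ 𝔭 : PrimeSpectrum (IwasawaAlgebra 2), 𝔭.asIdeal.height = 1 →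
                PowerSeries.C (2 : ℤ_[2]) ∈ 𝔭.asIdeal →
                Literature.NumberTheory.EllipticCurves.Module.lengthAt (IwasawaAlgebra 2) Y.X 𝔭 ≤
                  Literature.NumberTheory.EllipticCurves.Module.lengthAt (IwasawaAlgebra 2) (I.H ⧸ Z) 𝔭))
    (hμ : ∀ (W : WeierstrassCurve ℚ) [W.IsElliptic] [W.IsGloballyMinimal],
      ¬ W.HasCM → W.analyticRank = 0 → GoodSS W 2 → W.frobeniusTrace 2 = 0 →
      ¬ TwoAdicSurjective W →
      ∀ (κ : ZpExtension ℚ 2) (γ : Field.absoluteGaloisGroup ℚ),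
        κ.IsCyclotomic → κ.IsTopGenerator γ → IsCyclotomicVariable 2 γ →
        ∀ (D : SignedSelmerDualData W κ γ 1) (g : IwasawaAlgebra 2),
          D.charIdeal = Ideal.span {g} → ¬ PowerSeries.C (2 : ℤ_[2]) ∣ g)
    (hTwo : (∀ (W : WeierstrassCurve ℚ) [W.IsElliptic] [W.IsGloballyMinimal],
        ¬ W.HasCM → W.analyticRank = 0 → GoodSS W 2 →
          (W.frobeniusTrace 2 = 2 ∨ W.frobeniusTrace 2 = -2) → MissingLowerBoundAt W 2) ∧
      (∀ (W : WeierstrassCurve ℚ) [W.IsElliptic] [W.IsGloballyMinimal],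
        ¬ W.HasCM → W.analyticRank = 0 → GoodSS W 2 →
          (W.frobeniusTrace 2 = 2 ∨ W.frobeniusTrace 2 = -2) → MissingUpperBoundAt W 2)) :
    Summit.BirchSwinnertonDyer.BirchSwinnertonDyer.Theses.ByReductionTypeAtTwo.SupersingularRankZeroAtTwo :=
  supersingularRankZeroAtTwo_of_line_eulerChar hPub hEC hlow
    (zeroSignedUpper_of_colemanKatoV6AtTwo hKato.1 hKato.2 hCK hμ) hTwo

end SSColemanRoad
end Summit.BirchSwinnertonDyer.BirchSwinnertonDyer.Theorems

end
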